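import Literature.NumberTheory.LFunctions.DegreeOnePrimesPNT
import Literature.NumberTheory.LFunctions.MertensTail
import Literature.NumberTheory.Sieve.LargestPrimeFactorCubicLocal
import Mathlib.Algebra.BigOperators.Module
import Mathlib.Algebra.Order.Field.GeomSum
import HarnessLib

/-!
# Heath-Brown 2001, Lemma 2.2 (the Chebyshev–Hooley step) — II: the prime ideal theorem input

Topic `Literature/NumberTheory/Sieve`; second file of the proof of Heath-Brown's Lemma 2.2
(A. J. Irving, arXiv:1412.0024, Lemma 2.2; see `LargestPrimeFactorCubicLocal` for the statement
and the plan, `…SmoothSum` and `…Chebyshev` for the sequel).  Everything here is PROVED; no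
named facts.

With `ν(p) = #{r < p : p ∣ r³ + 2}`:

* `exists_abs_thetaNu_sub_le` : `θ_ν(N) = ∑_{p ≤ N} ν(p) log p = N + O(N/log² N)` — the prime
  ideal theorem for `ℚ(∛−2)` (tree:
  `Literature.NumberTheory.LFunctions.DegreeOnePrimes.abs_sum_primesLE_rootCount_mul_log_sub_self_le_logPow`,
  applied to `X³ + 2`, Eisenstein-irreducible by `…Local`);
* `sum_rootCount_mul_log_div_le` : `∑_{p ≤ N} ν(p) log p / p ≤ log N + K` by partial summation
  (`∑_{p≤N} a_p/p = θ_ν(N)/N + ∑_{m<N} θ_ν(m)/(m(m+1))`, `∑_m 1/((m+1) log² m) ≤ 2/log 2`) — the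
  Mertens-type main term of the Chebyshev–Hooley method;
* `primeCounting_mul_log_le` : Chebyshev's `π(N) log N ≤ 5N` from Mathlib's
  `Chebyshev.pi_le_log4_mul_div` (used for the prime-power error terms in `…SmoothSum`).

## References

* D. R. Heath-Brown, Proc. London Math. Soc. (3) 82 (2001) 554–596. [`HeathBrown2001LargestPrimeFactorCubic`]
* A. J. Irving, arXiv:1412.0024 (Acta Arith. 171 (2015)), §2, Lemma 2.2. [`Irving2014LargestPrimeFactorCubic`]
* E. Landau, Math. Ann. 56 (1903) 645–670 (prime ideal theorem). [`LandauMathAnn1903`]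
-/

noncomputable section

open Finset Real Polynomial

namespace Literature.NumberTheory.Sieve.LargestPrimeFactorCubic

open Literature.NumberTheory.LFunctions

/-! ### `θ_ν(x) = x + O(x / log² x)` from the prime ideal theorem -/

/-- **Prime ideal theorem for `X³ + 2`** at integers: there is `C ≥ 0` with
`|∑_{p ≤ N} ν(p) log p − N| ≤ C N / log² N` for all `N ≥ 2`, `ν(p) = #{r < p : p ∣ r³ + 2}`
(tree's `abs_sum_primesLE_rootCount_mul_log_sub_self_le_logPow`, `A = 2`).
[cite: LandauMathAnn1903, §13 p. 669] -/
theorem exists_abs_thetaNu_sub_le :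
    ∃ C : ℝ, 0 ≤ C ∧ ∀ N : ℕ, 2 ≤ N →
      |∑ p ∈ Nat.primesLE N, (#{r ∈ range p | p ∣ r ^ 3 + 2} : ℝ) * Real.log p - N| ≤
        C * N / Real.log N ^ 2 := by
  obtain ⟨C, hC⟩ := DegreeOnePrimes.abs_sum_primesLE_rootCount_mul_log_sub_self_le_logPow
    monic_X_pow_three_add_two irreducible_X_pow_three_add_two 2
  have key : ∀ N : ℕ, 2 ≤ N →
      |∑ p ∈ Nat.primesLE N, (#{r ∈ range p | p ∣ r ^ 3 + 2} : ℝ) * Real.log p - N| ≤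
        C * N / Real.log N ^ 2 := by
    intro N hN
    have h := hC N (by exact_mod_cast hN)
    rw [Nat.floor_natCast, Real.rpow_two] at h
    simpa only [rootCount_eq] using h
  refine ⟨C, ?_, key⟩
  have h := key 2 le_rfl
  have h2 : 0 < Real.log ((2 : ℕ) : ℝ) ^ 2 := pow_pos (Real.log_pos (by norm_num)) 2
  have h1 : 0 ≤ C * ((2 : ℕ) : ℝ) / Real.log ((2 : ℕ) : ℝ) ^ 2 := (abs_nonneg _).trans h
  rw [le_div_iff₀ h2, zero_mul] at h1
  have : (0 : ℝ) < ((2 : ℕ) : ℝ) := by norm_num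
  nlinarith

/-! ### Partial summation: `∑_{p ≤ N} ν(p) log p / p ≤ log N + O(1)` -/

/-- `1/(i+1) ≤ log(i+1) − log i` for `i ≥ 1`. [folklore] -/
theorem inv_succ_le_log_succ_sub_log {i : ℕ} (hi : 1 ≤ i) :
    1 / ((i : ℝ) + 1) ≤ Real.log ((i : ℝ) + 1) - Real.log i := by
  have hi0 : (0 : ℝ) < i := by exact_mod_cast hi
  have h := Real.one_sub_inv_le_log_of_pos (show (0 : ℝ) < (i + 1) / i by positivity)
  rw [Real.log_div (by positivity) hi0.ne', inv_div] at h
  have : 1 - (i : ℝ) / (i + 1) = 1 / ((i : ℝ) + 1) := by field_simp; ring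
  linarith

/-- `∑_{2 ≤ i < N} 1/(i+1) ≤ log N − log 2` (`N ≥ 2`). [folklore] -/
theorem sum_Ico_inv_succ_le {N : ℕ} (hN : 2 ≤ N) :
    ∑ i ∈ Ico 2 N, 1 / ((i : ℝ) + 1) ≤ Real.log N - Real.log 2 := by
  induction N, hN using Nat.le_induction with
  | base => simp
  | succ N hN ih =>
    rw [sum_Ico_succ_top hN, Nat.cast_succ]
    have := inv_succ_le_log_succ_sub_log (show 1 ≤ N by omega)
    linarith

/-- `1/((i+1) log² i) ≤ 2 (1/log i − 1/log(i+1))` for `i ≥ 2` (`log(i+1) ≤ 2 log i`,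
`log(i+1) − log i ≥ 1/(i+1)`). [folklore] -/
theorem inv_succ_mul_log_sq_le {i : ℕ} (hi : 2 ≤ i) :
    1 / (((i : ℝ) + 1) * Real.log i ^ 2) ≤ 2 * (1 / Real.log i - 1 / Real.log ((i : ℝ) + 1)) := by
  have hi' : (2 : ℝ) ≤ i := by exact_mod_cast hi
  have ha : 0 < Real.log i := Real.log_pos (by linarith)
  have hb : 0 < Real.log ((i : ℝ) + 1) := Real.log_pos (by linarith)
  have hba : 1 / ((i : ℝ) + 1) ≤ Real.log ((i : ℝ) + 1) - Real.log i :=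
    inv_succ_le_log_succ_sub_log (by omega)
  have hb2 : Real.log ((i : ℝ) + 1) ≤ 2 * Real.log i := by
    have : Real.log ((i : ℝ) ^ 2) = 2 * Real.log i := by
      rw [Real.log_pow]; norm_num
    rw [← this]
    exact Real.log_le_log (by linarith) (by nlinarith)
  set a := Real.log (i : ℝ) with ha_def
  set b := Real.log ((i : ℝ) + 1) with hb_def
  have ha' : a ≠ 0 := ha.ne'
  have hb' : b ≠ 0 := hb.ne'
  have hsub : 1 / a - 1 / b = (b - a) / (a * b) := by
    rw [div_sub_div _ _ ha' hb', one_mul, mul_one]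
  rw [hsub]
  have hd : 0 ≤ b - a := by
    have : 0 < 1 / ((i : ℝ) + 1) := by positivity
    linarith
  calc 1 / (((i : ℝ) + 1) * a ^ 2) = (1 / ((i : ℝ) + 1)) / (a * a) := by
        rw [div_div, pow_two]
    _ ≤ (b - a) / (a * a) := div_le_div_of_nonneg_right hba (by positivity)
    _ = 2 * ((b - a) / (2 * (a * a))) := by
        field_simp
    _ ≤ 2 * ((b - a) / (a * b)) := by
        gcongr 2 * ?_
        exact div_le_div_of_nonneg_left hd (by positivity) (by nlinarith)

/-- `∑_{2 ≤ i < N} 1/((i+1) log² i) ≤ 2 / log 2`. [folklore] -/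
theorem sum_Ico_inv_succ_mul_log_sq_le (N : ℕ) :
    ∑ i ∈ Ico 2 N, 1 / (((i : ℝ) + 1) * Real.log i ^ 2) ≤ 2 / Real.log 2 := by
  have htel : ∀ M : ℕ, 2 ≤ M →
      ∑ i ∈ Ico 2 M, (1 / Real.log i - 1 / Real.log ((i : ℝ) + 1)) =
        1 / Real.log 2 - 1 / Real.log M := by
    intro M hM
    induction M, hM using Nat.le_induction with
    | base => simp
    | succ M hM ih =>
      rw [sum_Ico_succ_top hM, ih, Nat.cast_succ]
      ring
  rcases lt_or_ge N 2 with hN | hN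
  · rw [Ico_eq_empty_of_le (by omega), sum_empty]
    exact div_nonneg zero_le_two (Real.log_nonneg one_le_two)
  calc ∑ i ∈ Ico 2 N, 1 / (((i : ℝ) + 1) * Real.log i ^ 2)
      ≤ ∑ i ∈ Ico 2 N, 2 * (1 / Real.log i - 1 / Real.log ((i : ℝ) + 1)) :=
        sum_le_sum fun i hi => inv_succ_mul_log_sq_le (mem_Ico.1 hi).1
    _ = 2 * (1 / Real.log 2 - 1 / Real.log N) := by rw [← mul_sum, htel N hN]
    _ ≤ 2 / Real.log 2 := by
        have : 0 ≤ 1 / Real.log (N : ℝ) :=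
          div_nonneg zero_le_one (Real.log_nonneg (by exact_mod_cast (show 1 ≤ N by omega)))
        rw [mul_sub, mul_one_div]
        linarith

/-- **`∑_{p ≤ N} ν(p) log p / p ≤ log N + K`** (`N ≥ 2`): partial summation from the prime ideal
theorem `θ_ν(m) ≤ m + C m/log² m` — `∑_{p≤N} a_p/p = θ_ν(N)/N + ∑_{m<N} θ_ν(m)/(m(m+1))` and
`∑_m 1/((m+1) log² m) < ∞`. (The Mertens-type input of the Chebyshev–Hooley method.)
[cite: Irving2014LargestPrimeFactorCubic, Lemma 2.2] -/
theorem sum_rootCount_mul_log_div_le :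
    ∃ K : ℝ, ∀ N : ℕ, 2 ≤ N →
      ∑ p ∈ Nat.primesLE N, (#{r ∈ range p | p ∣ r ^ 3 + 2} : ℝ) * Real.log p / p ≤
        Real.log N + K := by
  obtain ⟨C, hC0, hθ⟩ := exists_abs_thetaNu_sub_le
  have hlog2 : 0 < Real.log 2 := Real.log_pos one_lt_two
  refine ⟨1 + C / Real.log 2 ^ 2 + C * (2 / Real.log 2), fun N hN => ?_⟩
  set ν : ℕ → ℝ := fun p => (#{r ∈ range p | p ∣ r ^ 3 + 2} : ℝ) with hν
  set a : ℕ → ℝ := fun k => if k.Prime then ν k * Real.log k else 0 with ha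
  set w : ℕ → ℝ := fun k => 1 / (k : ℝ) with hw
  -- partial sums of `a` are `θ_ν`
  have hT : ∀ m : ℕ, ∑ k ∈ range (m + 1), a k = ∑ p ∈ Nat.primesLE m, ν p * Real.log p := by
    intro m
    rw [Nat.primesLE_eq_filter_range, sum_filter]
  have hT0 : ∀ m : ℕ, 0 ≤ ∑ k ∈ range (m + 1), a k := fun m =>
    sum_nonneg fun k _ => by
      simp only [ha]
      split_ifs with hk
      · exact mul_nonneg (Nat.cast_nonneg _) (Real.log_nonneg (by exact_mod_cast hk.one_lt.le))
      · exact le_rfl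
  have hTle : ∀ m : ℕ, 2 ≤ m → ∑ k ∈ range (m + 1), a k ≤ m + C * m / Real.log m ^ 2 := by
    intro m hm
    rw [hT]
    have := (abs_le.1 (hθ m hm)).2
    linarith
  have hT1 : ∀ m : ℕ, m < 2 → ∑ k ∈ range (m + 1), a k = 0 := by
    intro m hm
    refine sum_eq_zero fun k hk => ?_
    have : ¬ k.Prime := fun h => by have := h.two_le; rw [mem_range] at hk; omega
    simp [ha, this]
  -- the sum as `∑ w_k a_k`, and Abel summation
  have hS : ∑ p ∈ Nat.primesLE N, ν p * Real.log p / p = ∑ k ∈ range (N + 1), w k • a k := by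
    rw [Nat.primesLE_eq_filter_range, sum_filter]
    refine sum_congr rfl fun k _ => ?_
    simp only [ha, hw, smul_eq_mul]
    split_ifs
    · ring
    · simp
  rw [hS, sum_range_by_parts w a (N + 1), Nat.add_sub_cancel, sub_eq_add_neg, ← sum_neg_distrib]
  -- boundary term `θ_ν(N)/N ≤ 1 + C/log² 2`
  have hN' : (2 : ℝ) ≤ N := by exact_mod_cast hN
  have hlogN : Real.log 2 ≤ Real.log N := Real.log_le_log two_pos hN'
  have hbd : w N • ∑ k ∈ range (N + 1), a k ≤ 1 + C / Real.log 2 ^ 2 := by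
    simp only [hw, smul_eq_mul]
    calc 1 / (N : ℝ) * ∑ k ∈ range (N + 1), a k ≤ 1 / (N : ℝ) * (N + C * N / Real.log N ^ 2) :=
          mul_le_mul_of_nonneg_left (hTle N hN) (by positivity)
      _ = 1 + C / Real.log N ^ 2 := by field_simp
      _ ≤ 1 + C / Real.log 2 ^ 2 := by
          gcongr
  -- each Abel term
  have hterm : ∀ i ∈ range N, -((w (i + 1) - w i) • ∑ k ∈ range (i + 1), a k) ≤
      if 2 ≤ i then 1 / ((i : ℝ) + 1) + C * (1 / (((i : ℝ) + 1) * Real.log i ^ 2)) else 0 := by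
    intro i _
    split_ifs with hi
    · have hi' : (2 : ℝ) ≤ i := by exact_mod_cast hi
      have hwi : -(w (i + 1) - w i) = 1 / ((i : ℝ) * (i + 1)) := by
        simp only [hw, Nat.cast_succ]
        field_simp
        ring
      rw [smul_eq_mul, neg_mul_eq_neg_mul, hwi]
      calc 1 / ((i : ℝ) * (i + 1)) * ∑ k ∈ range (i + 1), a k
          ≤ 1 / ((i : ℝ) * (i + 1)) * (i + C * i / Real.log i ^ 2) :=
            mul_le_mul_of_nonneg_left (hTle i hi) (by positivity)
        _ = 1 / ((i : ℝ) + 1) + C * (1 / (((i : ℝ) + 1) * Real.log i ^ 2)) := by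
            field_simp
    · push Not at hi
      rw [hT1 i hi, smul_zero, neg_zero]
  have hIco : (range N).filter (fun i => 2 ≤ i) = Ico 2 N := by
    ext i; simp only [mem_filter, mem_range, mem_Ico]; omega
  calc w N • ∑ k ∈ range (N + 1), a k + ∑ i ∈ range N, -((w (i + 1) - w i) • ∑ k ∈ range (i + 1), a k)
      ≤ (1 + C / Real.log 2 ^ 2) + ∑ i ∈ range N,
          (if 2 ≤ i then 1 / ((i : ℝ) + 1) + C * (1 / (((i : ℝ) + 1) * Real.log i ^ 2)) else 0) :=
        add_le_add hbd (sum_le_sum hterm)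
    _ = (1 + C / Real.log 2 ^ 2) + (∑ i ∈ Ico 2 N, 1 / ((i : ℝ) + 1) +
          C * ∑ i ∈ Ico 2 N, 1 / (((i : ℝ) + 1) * Real.log i ^ 2)) := by
        rw [← sum_filter, hIco, sum_add_distrib, mul_sum]
    _ ≤ (1 + C / Real.log 2 ^ 2) + ((Real.log N - Real.log 2) + C * (2 / Real.log 2)) := by
        gcongr
        · exact sum_Ico_inv_succ_le hN
        · exact sum_Ico_inv_succ_mul_log_sq_le N
    _ ≤ Real.log N + (1 + C / Real.log 2 ^ 2 + C * (2 / Real.log 2)) := by linarith [hlog2.le]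

/-! ### Chebyshev: `π(N) log N ≤ 5N` -/

/-- **Chebyshev's bound** `π(N) log N ≤ 5N` (`N ≥ 2`), from Mathlib's
`π(x) ≤ (log 4) x / log √x + √x` and `log N ≤ 2√N`. [folklore] -/
theorem primeCounting_mul_log_le {N : ℕ} (hN : 2 ≤ N) :
    (Nat.primeCounting N : ℝ) * Real.log N ≤ 5 * N := by
  have hN1 : (1 : ℝ) < N := by exact_mod_cast (show 1 < N by omega)
  have hN0 : (0 : ℝ) < N := by linarith
  have h := Chebyshev.pi_le_log4_mul_div hN1
  rw [Nat.floor_natCast, Real.log_sqrt hN0.le] at h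
  have hlogN : 0 < Real.log N := Real.log_pos hN1
  have hsqrt : 0 < Real.sqrt N := Real.sqrt_pos.2 hN0
  -- `log N = 2 log √N ≤ 2 (√N − 1) < 2 √N`
  have hls : Real.log N ≤ 2 * Real.sqrt N := by
    have h1 := Real.log_le_sub_one_of_pos hsqrt
    rw [Real.log_sqrt hN0.le] at h1
    linarith
  have hlog4 : Real.log 4 ≤ 1.4 := by
    have : Real.log 4 = 2 * Real.log 2 := by
      rw [show (4 : ℝ) = 2 ^ 2 by norm_num, Real.log_pow]; norm_num
    rw [this]; linarith [Real.log_two_lt_d9]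
  have h' : (Nat.primeCounting N : ℝ) ≤ 2 * Real.log 4 * N / Real.log N + Real.sqrt N := by
    have : Real.log 4 * N / (Real.log N / 2) = 2 * Real.log 4 * N / Real.log N := by
      field_simp
    linarith [this ▸ h]
  calc (Nat.primeCounting N : ℝ) * Real.log N
      ≤ (2 * Real.log 4 * N / Real.log N + Real.sqrt N) * Real.log N :=
        mul_le_mul_of_nonneg_right h' hlogN.le
    _ = 2 * Real.log 4 * N + Real.sqrt N * Real.log N := by field_simp
    _ ≤ 2 * 1.4 * N + Real.sqrt N * (2 * Real.sqrt N) := by gcongr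
    _ ≤ 5 * N := by nlinarith [Real.mul_self_sqrt hN0.le]

end Literature.NumberTheory.Sieve.LargestPrimeFactorCubic
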